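import Summits.Ventures.Crystal3D.Bulk.LocalTwelve
import Summits.Ventures.Crystal3D.StickySpheres.RadiusOne
import Literature.Geometry.DiscreteGeometry.HalesTwelveNeighbourGap
import HarnessLib

/-!
# Bulk crystallization ⇐ GAP(δ) ∧ CLASSIFICATION(δ): the gap-parametric reduction

HONEST FRAMING. Part of the venture `Summits/Ventures/Crystal3D` (cell `pub-crystal3d`, phase 2,
`PLAN.md` R41 / `phase2/ENV-CENSUS/DESIGN-L12.md` §1). This file TYPES the two census targets of
the re-aimed phase 2 as Props PARAMETRIC IN THE GAP `δ` (Hales's normalisation: balls of unit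
RADIUS, touching centres at distance `2`), and PROVES the reduction

  `KissingGap δ → KissingClassification δ → L12Local`, hence `→ BulkCrystallization3D 1296`

(`L12Local`, `BulkCrystallization3D`, `IsClosePackedShell`, `contactShell` are the seat
`typer-bulk`'s definitions in `Bulk/LocalTwelve.lean`; the counting behind the constant
`1296 = 24 · 54` is there and in `Bulk/DefectCounting.lean`). Nothing is claimed: every theorem
below is either elementary or CONDITIONAL on named inputs, listed exactly.

* `KissingGap δ` — GAP(δ), point-set form: in a packing of unit balls, a centre touched by twelve
  balls has every other centre at distance `2` or `≥ δ`. The tree's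
  `hales2012_separation_local_of_L12` (`KissingTwelveLocal.lean`, seat lit-4) is
  `flyspeck_L12 → KissingGap (2h₀)`, `2h₀ = 2.52`.
* `GapTuple δ` — GAP(δ), fourteen-ball form (the shape of Böröczky–Szabó 2015, Theorem 3:
  `BoroczkySzabo2015_thm3 ↔ GapTuple 2.51838585` by `Iff.rfl`; `flyspeck_L12 → GapTuple 2.52` is
  the tree's `hales_twelveNeighbourGap_of_L12`); `GapTuple δ → KissingGap δ`
  (`kissingGap_of_gapTuple`, the enumeration of the twelve neighbours); diameter-one form
  `GapTupleDiam d₀ ↔ GapTuple (2 d₀)` for the cell's engines (contact distance `1`).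
* `IsGapKissingConfig δ S`, `KissingClassification δ` — Hales's class `𝒱` (Definition 1) and the
  classification "every `V ∈ 𝒱` is congruent to the FCC or HCP configuration" (Lemmas 9–10) with
  the gap `2h₀` replaced by `δ`: `KissingClassification (2h₀) ↔ Hales2012_kissingConfigCongruent`
  by `Iff.rfl`. Monotonicity: `KissingGap`/`GapTuple` are ANTITONE in `δ`,
  `KissingClassification` is MONOTONE in `δ`; the reduction needs both at ONE `δ`.
* THE REDUCTION (`isClosePackedShell_of_gap_of_classification`, `l12Local_of_gap_of_classification`,
  `bulkCrystallization3D_of_gap_of_classification`) and its two instances: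
  (G1) `δ = 2h₀`: `flyspeck_L12 → Hales2012_kissingConfigCongruent → BulkCrystallization3D 1296`
  (both inputs = the computer-assisted named facts of the tree's Hales-2012 formalisation; the same
  implication through `L12Local` is the seat typer-bulk's `Bulk/LocalTwelveOfHales.lean`);
  (G2) `δ = 2.51838585`: `BoroczkySzabo2015_thm3 → KissingClassification 2.51838585 →
  BulkCrystallization3D 1296` — Flyspeck-free in print on the gap side; the classification at the
  smaller gap is the census/search target the cell must certify (Hales's is at `2.52`).

Sources (for the vendored inputs; nothing new is vendored here): T. C. Hales, arXiv:1209.6043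
(2012), Lemma 1 (`flyspeck_L12`), Definition 1, Lemma 2, Lemmas 9–10; K. Böröczky, L. Szabó, Acta
Math. Hungar. 146 (2015), Theorem 3 (`BoroczkySzabo2015_thm3`); K. Bezdek, S. Reid, J. Geom. 104
(2013), Theorem 5 (the fourteen-ball gap).
-/

noncomputable section

open scoped BigOperators
open Finset

namespace Summit.Ventures.Crystal3D

open Literature.Geometry.DiscreteGeometry

/-! ## The two census targets, parametric in the gap -/

/-- **GAP(δ), point-set form** (radius-one balls). In every packing `V` of unit balls in `ℝ³`, a
centre `u ∈ V` touched by twelve balls of `V` (`(kissingShell V u).ncard = 12`) has every centre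
`v ∈ V` equal to `u`, touching `u` (`dist u v = 2`), or at distance `≥ δ`. LOCAL: nothing is
assumed about balls other than `u`. Hales 2012, Lemma 2 (local form, from `flyspeck_L12`) is
`KissingGap (2h₀) = KissingGap 2.52`; Böröczky–Szabó 2015, Corollary 1 / Theorem 3 give
`δ = 2.51838585`. A census target of the cell (route G1). -/
def KissingGap (δ : ℝ) : Prop :=
  ∀ V : Set (EuclideanSpace ℝ (Fin 3)), IsUnitBallPacking V →
    ∀ u ∈ V, (kissingShell V u).ncard = 12 →
      ∀ v ∈ V, u = v ∨ dist u v = 2 ∨ δ ≤ dist u v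

/-- **GAP(δ), fourteen-ball form** (the shape of Böröczky–Szabó 2015, Theorem 3, and of
Bezdek–Reid 2013, Theorem 5): for fourteen centres `c 0, …, c 13` of unit balls pairwise at
distance `≥ 2`, if `c 1, …, c 12` touch `c 0` then `dist (c 0) (c 13) ≥ δ`. -/
def GapTuple (δ : ℝ) : Prop :=
  ∀ c : Fin 14 → EuclideanSpace ℝ (Fin 3),
    (∀ i j : Fin 14, i ≠ j → (2 : ℝ) ≤ dist (c i) (c j)) →
    (∀ i : Fin 14, i ≠ 0 → i ≠ 13 → dist (c i) (c 0) = 2) →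
    δ ≤ dist (c 0) (c 13)

/-- **GAP, fourteen-ball form in the cell's diameter-one convention** (contact distance `1`, as in
`IsUnitPacking` and the cell's engines): centres pairwise `≥ 1` apart, `c 1, …, c 12` at distance
exactly `1` from `c 0` ⇒ `dist (c 0) (c 13) ≥ d₀`. Equivalent to `GapTuple (2 d₀)`
(`gapTupleDiam_iff`). -/
def GapTupleDiam (d₀ : ℝ) : Prop :=
  ∀ c : Fin 14 → EuclideanSpace ℝ (Fin 3),
    (∀ i j : Fin 14, i ≠ j → (1 : ℝ) ≤ dist (c i) (c j)) →
    (∀ i : Fin 14, i ≠ 0 → i ≠ 13 → dist (c i) (c 0) = 1) →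
    d₀ ≤ dist (c 0) (c 13)

/-- **A `δ`-gap kissing configuration**: Hales's class `𝒱` (Hales 2012, Definition 1: twelve points
of the sphere `S²(2)`, any two equal, touching, or `≥ 2h₀` apart) with the gap `2h₀ = 2.52`
replaced by the parameter `δ`; `IsGapKissingConfig (2h₀) S ↔ IsKissingConfig S` by `Iff.rfl`. -/
def IsGapKissingConfig (δ : ℝ) (S : Set (EuclideanSpace ℝ (Fin 3))) : Prop :=
  S.ncard = 12 ∧ (∀ x ∈ S, ‖x‖ = 2) ∧ ∀ x ∈ S, ∀ y ∈ S, x = y ∨ dist x y = 2 ∨ δ ≤ dist x y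

/-- **CLASSIFICATION(δ)**: every `δ`-gap kissing configuration is arranged in the FCC pattern
(cuboctahedron) or the HCP pattern (twisted cuboctahedron). At `δ = 2h₀` this is literally the
tree's named fact `Hales2012_kissingConfigCongruent` (Hales 2012, Lemmas 9–10, computer-assisted;
`kissingClassification_two_mul_hales_h0_iff`); at `δ = 2.51838585` it is the census/search target
of the cell's route G2. MONOTONE in `δ`. -/
def KissingClassification (δ : ℝ) : Prop :=
  ∀ S : Set (EuclideanSpace ℝ (Fin 3)), IsGapKissingConfig δ S →
    IsArrangedIn S fccKissingPattern ∨ IsArrangedIn S hcpKissingPattern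

/-! ## Identifications with the tree's statements -/

/-- `2h₀ = 2.52`. -/
theorem two_mul_hales_h0 : 2 * hales_h0 = 2.52 := by
  rw [hales_h0_eq]; norm_num

/-- Böröczky–Szabó 2015, Theorem 3, IS `GapTuple 2.51838585`. -/
theorem boroczkySzabo2015_thm3_iff : BoroczkySzabo2015_thm3 ↔ GapTuple 2.51838585 :=
  Iff.rfl

/-- Hales's class `𝒱` is the `2h₀`-gap class. -/
theorem isGapKissingConfig_two_mul_hales_h0_iff {S : Set (EuclideanSpace ℝ (Fin 3))} :
    IsGapKissingConfig (2 * hales_h0) S ↔ IsKissingConfig S :=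
  Iff.rfl

/-- Hales 2012, Lemmas 9–10 (the tree's named fact) IS `KissingClassification (2h₀)`. -/
theorem kissingClassification_two_mul_hales_h0_iff :
    KissingClassification (2 * hales_h0) ↔ Hales2012_kissingConfigCongruent :=
  Iff.rfl

/-- **GAP(2.52) from Flyspeck's `L12`**, fourteen-ball form: the tree's
`hales_twelveNeighbourGap_of_L12` (Bezdek–Reid 2013, Theorem 5). -/
theorem gapTuple_of_L12 (hL12 : flyspeck_L12) : GapTuple 2.52 :=
  hales_twelveNeighbourGap_of_L12 hL12

/-! ## Monotonicity in the gap -/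

/-- A smaller gap is a weaker requirement: `KissingGap` is antitone in `δ`. -/
theorem KissingGap.anti {δ δ' : ℝ} (h : δ' ≤ δ) (hg : KissingGap δ) : KissingGap δ' :=
  fun V hV u hu h12 v hv => (hg V hV u hu h12 v hv).imp_right (Or.imp_right h.trans)

/-- `GapTuple` is antitone in `δ`. -/
theorem GapTuple.anti {δ δ' : ℝ} (h : δ' ≤ δ) (hg : GapTuple δ) : GapTuple δ' :=
  fun c hpack htouch => h.trans (hg c hpack htouch)

/-- A configuration with a larger gap has every smaller gap. -/
theorem IsGapKissingConfig.anti {δ δ' : ℝ} {S : Set (EuclideanSpace ℝ (Fin 3))} (h : δ' ≤ δ)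
    (hS : IsGapKissingConfig δ S) : IsGapKissingConfig δ' S :=
  ⟨hS.1, hS.2.1, fun x hx y hy => (hS.2.2 x hx y hy).imp_right (Or.imp_right h.trans)⟩

/-- A classification at a smaller gap classifies more configurations: `KissingClassification` is
monotone in `δ`. In particular a certified `KissingClassification 2.51838585` re-proves Hales's
classification at `2.52`. -/
theorem KissingClassification.mono {δ δ' : ℝ} (h : δ ≤ δ') (hc : KissingClassification δ) :
    KissingClassification δ' :=
  fun S hS => hc S (hS.anti h)

/-! ## Fourteen balls ⇒ point sets, and the diameter-one form -/

/-- **The fourteen-ball form implies the point-set form**: enumerate the twelve balls touching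
`u` and adjoin `u` and `v`. -/
theorem kissingGap_of_gapTuple {δ : ℝ} (h : GapTuple δ) : KissingGap δ := by
  intro V hV u hu h12 v hv
  by_cases huv : u = v
  · exact Or.inl huv
  by_cases h2 : dist u v = 2
  · exact Or.inr (Or.inl h2)
  refine Or.inr (Or.inr ?_)
  -- enumerate the shell of `u` by `Fin 12`
  have hfin : (kissingShell V u).Finite :=
    Set.finite_of_ncard_ne_zero (by rw [h12]; norm_num)
  have hF : hfin.toFinset.card = 12 := by
    rw [← Set.ncard_eq_toFinset_card _ hfin]; exact h12
  let e := Finset.equivFinOfCardEq hF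
  let f : Fin 12 → EuclideanSpace ℝ (Fin 3) := fun k => ((e.symm k : hfin.toFinset) : _)
  have hfmem : ∀ k, u + f k ∈ V ∧ ‖f k‖ = 2 := fun k => by
    have hk : f k ∈ hfin.toFinset := (e.symm k).2
    exact (Set.Finite.mem_toFinset hfin).1 hk
  have hfinj : Function.Injective f := fun a b hab =>
    e.symm.injective (Subtype.ext hab)
  have hf0 : ∀ k, f k ≠ 0 := fun k hk => by
    have := (hfmem k).2; rw [hk, norm_zero] at this; norm_num at this
  have hfv : ∀ k, u + f k ≠ v := fun k hk => h2 (by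
    rw [← hk, dist_eq_norm, sub_add_cancel_left, norm_neg, (hfmem k).2])
  -- the fourteen centres: `u`, the twelve balls touching `u` (indices `1, …, 12`), and `v`
  let g : Fin 14 → EuclideanSpace ℝ (Fin 3) := fun k =>
    u + f ⟨((k : ℕ) - 1) % 12, Nat.mod_lt _ (by norm_num)⟩
  let c : Fin 14 → EuclideanSpace ℝ (Fin 3) := fun k =>
    if k = 0 then u else if k = 13 then v else g k
  have hc0 : c 0 = u := by simp [c]
  have hc13 : c 13 = v := by simp [c]
  have hcmid : ∀ k : Fin 14, k ≠ 0 → k ≠ 13 → c k = g k := fun k hk0 hk13 => by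
    simp [c, hk0, hk13]
  have hgmem : ∀ k, g k ∈ V := fun k => (hfmem _).1
  have hgu : ∀ k, g k ≠ u := fun k hk => hf0 _ (add_eq_left.1 hk)
  have hgv : ∀ k, g k ≠ v := fun k => hfv _
  have hmem : ∀ k, c k ∈ V := fun k => by
    by_cases hk0 : k = 0
    · rw [hk0, hc0]; exact hu
    by_cases hk13 : k = 13
    · rw [hk13, hc13]; exact hv
    rw [hcmid k hk0 hk13]; exact hgmem k
  -- distinct middle indices carry distinct centres
  have hginj : ∀ i j : Fin 14, i ≠ 0 → i ≠ 13 → j ≠ 0 → j ≠ 13 → g i = g j → i = j := by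
    intro i j hi0 hi13 hj0 hj13 hij
    have h' := congrArg Fin.val (hfinj (add_left_cancel hij))
    simp only at h'
    have hi0' : (i : ℕ) ≠ 0 := fun h => hi0 (Fin.ext h)
    have hi13' : (i : ℕ) ≠ 13 := fun h => hi13 (Fin.ext h)
    have hj0' : (j : ℕ) ≠ 0 := fun h => hj0 (Fin.ext h)
    have hj13' : (j : ℕ) ≠ 13 := fun h => hj13 (Fin.ext h)
    have hi := i.isLt
    have hj := j.isLt
    exact Fin.ext (by omega)
  have hne : ∀ i j : Fin 14, i ≠ j → c i ≠ c j := by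
    intro i j hij hcij
    by_cases hi0 : i = 0
    · subst hi0
      by_cases hj13 : j = 13
      · subst hj13; rw [hc0, hc13] at hcij; exact huv hcij
      rw [hc0, hcmid j (Ne.symm hij) hj13] at hcij
      exact hgu j hcij.symm
    by_cases hi13 : i = 13
    · subst hi13
      by_cases hj0 : j = 0
      · subst hj0; rw [hc0, hc13] at hcij; exact huv hcij.symm
      rw [hc13, hcmid j hj0 (Ne.symm hij)] at hcij
      exact hgv j hcij.symm
    by_cases hj0 : j = 0
    · subst hj0; rw [hc0, hcmid i hi0 hi13] at hcij
      exact hgu i hcij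
    by_cases hj13 : j = 13
    · subst hj13; rw [hc13, hcmid i hi0 hi13] at hcij
      exact hgv i hcij
    rw [hcmid i hi0 hi13, hcmid j hj0 hj13] at hcij
    exact hij (hginj i j hi0 hi13 hj0 hj13 hcij)
  have hpack : ∀ i j : Fin 14, i ≠ j → (2 : ℝ) ≤ dist (c i) (c j) := fun i j hij =>
    hV.two_le_dist (hmem i) (hmem j) (hne i j hij)
  have htouch : ∀ i : Fin 14, i ≠ 0 → i ≠ 13 → dist (c i) (c 0) = 2 := fun i hi0 hi13 => by
    rw [hcmid i hi0 hi13, hc0, dist_eq_norm, add_sub_cancel_left]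
    exact (hfmem _).2
  have := h c hpack htouch
  rwa [hc0, hc13] at this

/-- **GAP(2h₀) from Flyspeck's `L12`**, point-set form (also the tree's local Lemma 2,
`hales2012_separation_local_of_L12` of `KissingTwelveLocal.lean`, seat lit-4; obtained here from
the fourteen-ball form). -/
theorem kissingGap_two_mul_hales_h0_of_L12 (hL12 : flyspeck_L12) : KissingGap (2 * hales_h0) := by
  rw [two_mul_hales_h0]
  exact kissingGap_of_gapTuple (gapTuple_of_L12 hL12)

/-- Halving centres: distances halve. -/
theorem dist_half_smul (p q : EuclideanSpace ℝ (Fin 3)) :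
    dist ((1 / 2 : ℝ) • p) ((1 / 2 : ℝ) • q) = (1 / 2) * dist p q := by
  rw [dist_smul₀, Real.norm_of_nonneg (by norm_num : (0 : ℝ) ≤ 1 / 2)]

/-- **The diameter-one and radius-one fourteen-ball forms are equivalent** (scale by `2`). -/
theorem gapTupleDiam_iff (d₀ : ℝ) : GapTupleDiam d₀ ↔ GapTuple (2 * d₀) := by
  constructor
  · intro h c hpack htouch
    have h' := h (fun i => (1 / 2 : ℝ) • c i) (fun i j hij => by
        rw [dist_half_smul]; linarith [hpack i j hij])
      (fun i hi0 hi13 => by rw [dist_half_smul, htouch i hi0 hi13]; norm_num)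
    rw [dist_half_smul] at h'
    linarith
  · intro h c hpack htouch
    have h' := h (fun i => (2 : ℝ) • c i) (fun i j hij => by
        rw [dist_two_smul]; linarith [hpack i j hij])
      (fun i hi0 hi13 => by rw [dist_two_smul, htouch i hi0 hi13]; norm_num)
    rw [dist_two_smul] at h'
    linarith

/-! ## The reduction -/

/-- **Shells are `δ`-gap configurations under GAP(δ)** (Hales's "shells lie in `𝒱`", run at one
centre): if `u` is touched by twelve balls of the packing `V` and every ball touching `u` is itself
touched by twelve, then GAP(δ) at each neighbour separates the neighbours of `u` from one another,
so the kissing shell of `u` is a `δ`-gap kissing configuration. (`u ∈ V` is not needed.) -/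
theorem isGapKissingConfig_kissingShell {δ : ℝ} (hg : KissingGap δ)
    {V : Set (EuclideanSpace ℝ (Fin 3))} {u : EuclideanSpace ℝ (Fin 3)} (hV : IsUnitBallPacking V)
    (h12 : (kissingShell V u).ncard = 12)
    (hnb : ∀ w ∈ V, dist u w = 2 → (kissingShell V w).ncard = 12) :
    IsGapKissingConfig δ (kissingShell V u) := by
  refine ⟨h12, fun y hy => hy.2, fun y hy z hz => ?_⟩
  have hw : dist u (u + y) = 2 := by rw [dist_eq_norm, sub_add_cancel_left, norm_neg, hy.2]
  have h := hg V hV (u + y) hy.1 (hnb (u + y) hy.1 hw) (u + z) hz.1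
  rw [dist_add_left] at h
  rcases h with h | h
  · exact Or.inl (add_left_cancel h)
  · exact Or.inr h

/-- **Bridge**: the contact shell of ball `i` (seat typer-bulk's `contactShell`, the doubled
contact vectors) is the Literature's kissing shell of the centre `2·xᵢ` in the doubled point set
`2·range x`. -/
theorem kissingShell_two_smul_range_eq_contactShell {N : ℕ}
    (x : Fin N → EuclideanSpace ℝ (Fin 3)) (i : Fin N) :
    kissingShell (Set.range fun j => (2 : ℝ) • x j) ((2 : ℝ) • x i) = contactShell x i := by
  ext z
  simp only [mem_kissingShell_iff, Set.mem_range, mem_contactShell, mem_contactNeighbors]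
  constructor
  · rintro ⟨⟨j, hj⟩, hz⟩
    have hzj : z = (2 : ℝ) • (x j - x i) := by rw [smul_sub, hj]; abel
    refine ⟨j, ⟨?_, ?_⟩, hzj.symm⟩
    · rintro rfl
      rw [sub_self, smul_zero] at hzj
      rw [hzj, norm_zero] at hz
      norm_num at hz
    · rw [hzj, norm_smul, Real.norm_two, ← dist_eq_norm, dist_comm] at hz
      linarith
  · rintro ⟨j, ⟨-, hd⟩, rfl⟩
    refine ⟨⟨j, by rw [smul_sub]; abel⟩, ?_⟩
    rw [norm_smul, Real.norm_two, ← dist_eq_norm, dist_comm, hd]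
    norm_num

/-- In the doubled point set, a centre at distance `2` from `2·xᵢ` is `2·xⱼ` for a contact
neighbour `j` of `i`. -/
theorem exists_mem_contactNeighbors_of_dist_two_smul {N : ℕ} {x : Fin N → EuclideanSpace ℝ (Fin 3)}
    {i : Fin N} {w : EuclideanSpace ℝ (Fin 3)} (hw : w ∈ Set.range fun j => (2 : ℝ) • x j)
    (hd : dist ((2 : ℝ) • x i) w = 2) : ∃ j ∈ contactNeighbors x i, w = (2 : ℝ) • x j := by
  obtain ⟨j, rfl⟩ := hw
  refine ⟨j, (mem_contactNeighbors x).2 ⟨?_, ?_⟩, rfl⟩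
  · rintro rfl
    rw [dist_self] at hd
    norm_num at hd
  · rw [dist_two_smul] at hd
    linarith

/-- **The reduction at one ball.** Under GAP(δ) and CLASSIFICATION(δ) (any one `δ`): in a packing
of unit-diameter balls in `ℝ³`, a ball with twelve contacts all of whose contact neighbours have
twelve contacts has a close-packed (FCC or HCP) first shell. -/
theorem isClosePackedShell_of_gap_of_classification {δ : ℝ} (hg : KissingGap δ)
    (hc : KissingClassification δ) {N : ℕ} {x : Fin N → EuclideanSpace ℝ (Fin 3)}
    (hx : IsUnitPacking x) {i : Fin N} (hi : coordination x i = 12)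
    (hnb : ∀ j ∈ contactNeighbors x i, coordination x j = 12) : IsClosePackedShell x i := by
  have hV := ((isUnitPacking_iff_two_smul x).1 hx).2
  rw [IsClosePackedShell, ← kissingShell_two_smul_range_eq_contactShell]
  refine hc _ (isGapKissingConfig_kissingShell hg hV ?_ fun w hw hd => ?_)
  · rw [kissingShell_two_smul_range_eq_contactShell, ncard_contactShell hx, hi]
  · obtain ⟨j, hj, rfl⟩ := exists_mem_contactNeighbors_of_dist_two_smul hw hd
    rw [kissingShell_two_smul_range_eq_contactShell, ncard_contactShell hx, hnb j hj]

/-- **GAP(δ) ∧ CLASSIFICATION(δ) ⇒ `L12Local`** (the cell's local twelve-neighbour lemma, seat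
typer-bulk's definition), for any one `δ`. -/
theorem l12Local_of_gap_of_classification {δ : ℝ} (hg : KissingGap δ)
    (hc : KissingClassification δ) : L12Local :=
  fun _N _x hx _i hi hnb => isClosePackedShell_of_gap_of_classification hg hc hx hi hnb

/-- **GAP(δ) ∧ CLASSIFICATION(δ) ⇒ bulk crystallization with `K = 1296`**, for any one `δ`
(through `bulkCrystallization3D_of_L12Local`): in every sticky ground state of `N` hard unit
spheres all but at most `1296·N^{2/3}` balls have an FCC or HCP first shell. -/
theorem bulkCrystallization3D_of_gap_of_classification {δ : ℝ} (hg : KissingGap δ)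
    (hc : KissingClassification δ) : BulkCrystallization3D 1296 :=
  bulkCrystallization3D_of_L12Local (l12Local_of_gap_of_classification hg hc)

/-! ## The two instances -/

/-- **(G1) Bulk crystallization from Hales's two computer-assisted inputs**: `flyspeck_L12`
(Hales 2012, Lemma 1: GAP(2.52)) and `Hales2012_kissingConfigCongruent` (Lemmas 9–10:
CLASSIFICATION(2.52)) give `BulkCrystallization3D 1296`. Trust base = these two named facts of
`Literature/Geometry/DiscreteGeometry/` (the second is also discharged in the tree by a verified
search using `native_decide`, `Hales2012_kissingConfigCongruent_holds`, not used here so that the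
axioms stay standard). The same implication via `L12Local` is seat typer-bulk's
`Bulk/LocalTwelveOfHales.lean`. -/
theorem bulkCrystallization3D_of_L12_of_kissingConfigCongruent (hL12 : flyspeck_L12)
    (hcl : Hales2012_kissingConfigCongruent) : BulkCrystallization3D 1296 :=
  bulkCrystallization3D_of_gap_of_classification (kissingGap_two_mul_hales_h0_of_L12 hL12)
    (kissingClassification_two_mul_hales_h0_iff.2 hcl)

/-- **(G2) Bulk crystallization from Böröczky–Szabó's Flyspeck-free gap and a classification at
that gap**: `BoroczkySzabo2015_thm3` (Theorem 3: GAP(2.51838585), fourteen-ball form, printed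
proof via the Tammes-13 angle) and `KissingClassification 2.51838585` (the cell's census/search
target: Hales's classification re-run at the smaller gap) give `BulkCrystallization3D 1296`. -/
theorem bulkCrystallization3D_of_boroczkySzabo_of_classification (hBS : BoroczkySzabo2015_thm3)
    (hc : KissingClassification 2.51838585) : BulkCrystallization3D 1296 :=
  bulkCrystallization3D_of_gap_of_classification (kissingGap_of_gapTuple hBS) hc

/-- **(G1') from the fourteen-ball form**: a certified `GapTupleDiam d₀` (diameter-one engines)
together with a classification at gap `2 d₀` gives `BulkCrystallization3D 1296`. -/
theorem bulkCrystallization3D_of_gapTupleDiam_of_classification {d₀ : ℝ} (hg : GapTupleDiam d₀)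
    (hc : KissingClassification (2 * d₀)) : BulkCrystallization3D 1296 :=
  bulkCrystallization3D_of_gap_of_classification
    (kissingGap_of_gapTuple ((gapTupleDiam_iff d₀).1 hg)) hc

end Summit.Ventures.Crystal3D

end
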